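import Summits.SmoothPoincare4.SmoothPoincare4.Theorems.SymplecticOrigamiGromovRecognitionRelEndLeafCoordinate
import Summits.SmoothPoincare4.SmoothPoincare4.Theorems.SymplecticOrigamiGromovRecognitionRelEndHelperNormalWitnessTransfer

/-!
# Around a leaf, the local foliation is a smooth family of leaves — without the adjunction fact
(registered helpers `helper_leaf_chartC2` and `helper_leafCoordinateC2` of line `cross-cap-laurent`,
crux `GromovRecognitionRelEnd`, item stmt-SmoothPoincare4-11009; the integration lemmas L5 and J11
of the glue of the bi-foliation, re-routed around the adjunction fact)

Setting: `(X, JX)` a compact connected almost complex 4-manifold, `F₀ : C(ℂℙ¹, X)` a reference glued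
map, the local foliation fact `hls_localFoliation_embeddedSphere_trivialNormal` (F1) as the ONLY
hypothesis, and a LEAF `(u, v)` of the family of `F₀` (`IsLeafOf`: an embedded `JX`-holomorphic
two-chart sphere with a trivial-normal-bundle witness `(N, π)` whose glued map `F` is homotopic to
`F₀`).

These are the tree theorems `helper_leaf_chart` (L5, file `…LeafChart.lean`) and
`helper_leafCoordinate` (J11, file `…LeafCoordinate.lean`) with the hypothesis
`adjunction_embedded_of_somewhereInjective_sphere` (F4) DELETED.  In `helper_leaf_chart` the fact
F4 was applied only to produce a trivial-normal-bundle witness for a member `(U a, V a)`,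
`‖a‖ < ε`, of the local foliation around the leaf; that member is already EMBEDDED (a clause of
F1), and its glued map `G` is homotopic to the glued map `F` of `(u, v) = (U 0, V 0)` through the
glued maps of the family (`helper_gluedFamilyHomotopic`).  So the witness is provided instead by
the landed transfer theorem `helper_normalWitnessTransfer` (the differential-topology half C2 of
the adjunction apex): the trivial-normal-bundle witness `(N, π)` of the embedded sphere `(u, v)`
transfers along `G ∼ F` to the embedded sphere `(U a, V a)`.  `helper_leafCoordinateC2` is the
proof of `helper_leafCoordinate` verbatim over `helper_leaf_chartC2`: the leaf parameter of the
foliation by leaves (`helper_foliationCoordinate`) is a normal witness whose kernels are the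
tangent lines of the `JX`-holomorphic leaves, hence `JX`-invariant.

References: C. Wendl, *Holomorphic Curves in Low Dimensions*, LNM 2216 (2018), Prop. 2.53,
Thm. 2.49; H. Hofer, V. Lizan, J.-C. Sikorav, J. Geom. Anal. 7 (1997), Thm. 1; R. Kirby,
*The Topology of 4-Manifolds*, LNM 1374 (1989), Ch. VIII, Thm. 2.  No new definitions, notation or
instances.
-/

noncomputable section

open scoped Manifold ContDiff Topology
open Set Function Filter Literature.Topology.FourManifolds Literature.Topology.FourManifolds.ComplexProjectiveSpace
  Literature.Geometry.Symplectic

-- the prescribed namespace `Summit.<P>.<Sub>.…` duplicates `SmoothPoincare4` (P = Sub)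
set_option linter.dupNamespace false

namespace Summit.SmoothPoincare4.SmoothPoincare4.Theorems.GromovRecognitionRelEnd.CrossCapLaurent

/-- **L5 without the adjunction fact (registered helper `helper_leaf_chartC2`): around a leaf, the
local foliation fact gives a smooth family of LEAVES sweeping an open neighbourhood.**  For a leaf
`(u, v)` of the family of `F₀` (`IsLeafOf (fun y => JX y) F₀ u v`), the local foliation fact
`hls_localFoliation_embeddedSphere_trivialNormal` (a hypothesis) yields `ε > 0` and a family
`(U a, V a)`, `‖a‖ < ε`, with `U 0 = u`, `V 0 = v` pointwise, jointly smooth on `ball 0 ε × ℂ`,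
pairwise disjoint, with injective differentials, sweeping out an open set; and every member is a
leaf of the family of `F₀`: embedded by the fact, glued map `G` homotopic to `F₀` through the
family (`helper_gluedFamilyHomotopic`), trivial normal bundle by transfer of the witness of
`(u, v)` along `G ∼ F` (`helper_normalWitnessTransfer`, Kirby 1989 Ch. VIII Thm. 2). -/
theorem helper_leaf_chartC2 : ∀ (X : Type) [TopologicalSpace X] [T2Space X] [SecondCountableTopology X] [CompactSpace X] [ConnectedSpace X] [ChartedSpace (EuclideanSpace ℝ (Fin 4)) X] [IsManifold (𝓡 4) ∞ X] (JX : Literature.Geometry.Symplectic.AlmostComplexStructure (𝓡 4) ∞ X) (F₀ : C(Literature.Topology.FourManifolds.ComplexProjectiveSpace 1, X)), Literature.Geometry.Symplectic.hls_localFoliation_embeddedSphere_trivialNormal → ∀ (u v : ℂ → X), Summit.SmoothPoincare4.SmoothPoincare4.Theorems.GromovRecognitionRelEnd.CrossCapLaurent.IsLeafOf (fun y => JX y) F₀ u v → ∃ (ε : ℝ) (U V : ℂ → ℂ → X), 0 < ε ∧ (∀ z, U 0 z = u z) ∧ (∀ w, V 0 w = v w) ∧ (∀ a : ℂ, ‖a‖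 < ε → Summit.SmoothPoincare4.SmoothPoincare4.Theorems.GromovRecognitionRelEnd.CrossCapLaurent.IsLeafOf (fun y => JX y) F₀ (U a) (V a)) ∧ ContMDiffOn 𝓘(ℝ, ℂ × ℂ) (𝓡 4) ∞ (fun q : ℂ × ℂ => U q.1 q.2) (Metric.ball 0 ε ×ˢ Set.univ) ∧ ContMDiffOn 𝓘(ℝ, ℂ × ℂ) (𝓡 4) ∞ (fun q : ℂ × ℂ => V q.1 q.2) (Metric.ball 0 ε ×ˢ Set.univ) ∧ (∀ a a' : ℂ, ‖a‖ < ε → ‖a'‖ < ε → a ≠ a' → Disjoint (Set.range (U a) ∪ {V a 0}) (Set.range (U a') ∪ {V a' 0})) ∧ (∀ q ∈ Metric.ball (0 : ℂ) ε ×ˢ (Set.univ : Set ℂ), Function.Injective (mfderiv 𝓘(ℝ, ℂ × ℂ) (𝓡 4) (fun q : ℂ × ℂ => U q.1 q.2) q) ∧ Function.Injective (mfderiv 𝓘(ℝ, ℂ × ℂ) (𝓡 4) (fun q : ℂ × ℂ => V q.1 q.2) q)) ∧ IsOpen (⋃ a ∈ Metric.ball (0 : ℂ) ε, (Set.range (U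 a) ∪ {V a 0})) := by
  intro X _ _ _ _ _ _ _ JX F₀ hF1 u v h
  obtain ⟨hS, hE, ⟨N, P, hN⟩, ⟨F, hF, hFF₀⟩⟩ := h
  -- the local foliation around the leaf
  obtain ⟨ε, U, V, hε, hU0, hV0, hleaf, hUs, hVs, hdisj, hinj, hopen, -⟩ :=
    hF1 X JX u v N P hS.smooth_u hS.smooth_v hS.compat hS.hol_u hS.hol_v hE.injective hE.imm_u
      hE.imm_v hE.infty_notMem hN.isOpen hN.image_subset hN.smooth hN.submersive hN.zeroSet_eq
  refine ⟨ε, U, V, hε, hU0, hV0, fun a ha => ?_, hUs, hVs, hdisj, hinj, hopen⟩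
  -- every member `(U a, V a)`, `‖a‖ < ε`, is a leaf of the family of `F₀`
  have hε0 : ‖(0 : ℂ)‖ < ε := by simpa using hε
  have hUV : ∀ a : ℂ, ‖a‖ < ε → ∀ z : ℂ, z ≠ 0 → V a z = U a z⁻¹ :=
    fun a ha => (hleaf a ha).2.2.1
  obtain ⟨hUa, hVa, hcomp, hholU, hholV, hinjU, himmU, himmV, hinf⟩ := hleaf a ha
  -- the glued map `G` of the member `a`
  obtain ⟨G, hG0, hG1⟩ := helper_gluedExists X (U a) (V a) hUa.continuous hVa.continuous hcomp
  -- `F` is a glued map of the member `0 = (u, v)` (pointwise)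
  have hFz : ∀ p, CoordNeZero 0 p → F p = U 0 (affineCoordComplex 0 p 0) := fun p hp => by
    rw [hU0]
    exact hF.chart_zero p hp
  have hFo : ∀ p, CoordNeZero 1 p → F p = V 0 (affineCoordComplex 1 p 0) := fun p hp => by
    rw [hV0]
    exact hF.chart_one p hp
  -- `G ∼ F` through the glued maps of the family along the segment from `a` to `0`
  have hGF : G.Homotopic F :=
    helper_gluedFamilyHomotopic X ε U V a 0 G F ha hε0 hUs.continuousOn hVs.continuousOn hUV hG0
      hG1 hFz hFo
  -- trivial normal bundle by TRANSFER of the witness `(N, P)` of the embedded sphere `(u, v)` along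
  -- `G ∼ F` to the embedded member `(U a, V a)` (no adjunction, no `JX`-holomorphy needed)
  obtain ⟨N', P', hN'⟩ := helper_normalWitnessTransfer X JX u v N P (U a) (V a) G F hS.smooth_u
    hS.smooth_v hS.compat hE.injective hE.imm_u hE.imm_v hE.infty_notMem hN.isOpen hN.image_subset
    hN.smooth hN.submersive hN.zeroSet_eq hUa hVa hcomp hinjU himmU himmV hinf hG0 hG1
    hF.chart_zero hF.chart_one hGF
  exact ⟨⟨hUa, hVa, hcomp, hholU, hholV⟩, ⟨hinjU, himmU, himmV, hinf⟩,
    ⟨N', P', (isNormalWitness_iff N' P' (U a) (V a)).2 hN'⟩, ⟨G, ⟨hG0, hG1⟩, hGF.trans hFF₀⟩⟩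

/-- **J11 without the adjunction fact (registered helper `helper_leafCoordinateC2`): the FOLIATION
COORDINATE of a leaf is a normal witness with `JX`-invariant kernels on its whole (open) domain.**
The local foliation by leaves around `(u, v)` (`helper_leaf_chartC2`, using only the fact F1 given
as a hypothesis) has a smooth submersive leaf parameter `π` on the open union `N` of its leaves
(`helper_foliationCoordinate`), with `{y ∈ N | π y = 0} = range u ∪ {v 0}` and
`ker dπ_y = ` the tangent line of the leaf through `y`, which is `JX`-invariant since the leaves
are `JX`-holomorphic curves. -/
theorem helper_leafCoordinateC2 : ∀ (X : Type) [TopologicalSpace X] [T2Space X] [SecondCountableTopology X] [CompactSpace X] [ConnectedSpace X] [ChartedSpace (EuclideanSpace ℝ (Fin 4)) X] [IsManifold (𝓡 4) ∞ X] (JX : Literature.Geometry.Symplectic.AlmostComplexStructure (𝓡 4) ∞ X) (F₀ : C(Literature.Topology.FourManifolds.ComplexProjectiveSpace 1, X)), Literature.Geometry.Symplectic.hls_localFoliation_embeddedSphere_trivialNormal → ∀ (u v : ℂ → X), Summit.SmoothPoincare4.SmoothPoincare4.Theorems.GromovRecognitionRelEnd.CrossCapLaurent.IsLeafOf (fun y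 => JX y) F₀ u v → ∃ (N : Set X) (π : X → ℂ), Summit.SmoothPoincare4.SmoothPoincare4.Theorems.GromovRecognitionRelEnd.CrossCapLaurent.IsNormalWitness N π u v ∧ ∀ y ∈ N, ∀ ξ : TangentSpace (𝓡 4) y, mfderiv (𝓡 4) 𝓘(ℝ, ℂ) π y ξ = 0 → mfderiv (𝓡 4) 𝓘(ℝ, ℂ) π y (JX y ξ) = 0 := by
  intro X _ _ _ _ _ _ _ JX F₀ hF1 u v h
  -- the local foliation by leaves around `(u, v)`
  obtain ⟨ε, U, V, hε, hU0, hV0, hleaf, hUs, hVs, hdisj, hinj, hopen⟩ :=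
    helper_leaf_chartC2 X JX F₀ hF1 u v h
  -- the per-leaf hypothesis of the foliation coordinate, read off `IsLeafOf`
  have hper : ∀ a : ℂ, ‖a‖ < ε →
      ContMDiff 𝓘(ℝ, ℂ) (𝓡 4) ∞ (U a) ∧ ContMDiff 𝓘(ℝ, ℂ) (𝓡 4) ∞ (V a) ∧
      (∀ z : ℂ, z ≠ 0 → V a z = U a z⁻¹) ∧
      Injective (U a) ∧ (∀ z, Injective (mfderiv 𝓘(ℝ, ℂ) (𝓡 4) (U a) z)) ∧
      Injective (mfderiv 𝓘(ℝ, ℂ) (𝓡 4) (V a) 0) ∧ V a 0 ∉ range (U a) := fun a ha =>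
    ⟨(hleaf a ha).sphere.smooth_u, (hleaf a ha).sphere.smooth_v, (hleaf a ha).sphere.compat,
      (hleaf a ha).embedded.injective, (hleaf a ha).embedded.imm_u, (hleaf a ha).embedded.imm_v,
      (hleaf a ha).embedded.infty_notMem⟩
  -- the leaf parameter `π`
  obtain ⟨π, hπs, hπsub, -, -, hlevel, hkerU, hkerV⟩ :=
    helper_foliationCoordinate X ε U V hε hper hUs hVs hdisj hinj hopen
  have hε0 : ‖(0 : ℂ)‖ < ε := by simpa using hε
  have hu : U 0 = u := funext hU0
  have hv0 : V 0 0 = v 0 := hV0 0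
  refine ⟨⋃ a ∈ Metric.ball (0 : ℂ) ε, (range (U a) ∪ {V a 0}), π, ⟨hopen, ?_, hπs, hπsub, ?_⟩, ?_⟩
  · -- the image `range u ∪ {v 0} = range (U 0) ∪ {V 0 0}` is the leaf `a = 0`
    rw [← hu, ← hv0]
    exact fun y hy => mem_iUnion₂.mpr ⟨0, Metric.mem_ball_self hε, hy⟩
  · -- the zero set of `π` in `N` is the leaf `a = 0`
    rw [← hu, ← hv0]
    exact hlevel 0 hε0
  · -- `JX`-invariance of the kernels: `ker dπ_y` is the tangent line of the `JX`-curve through `y`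
    intro y hy ξ hξ
    rw [mem_iUnion₂] at hy
    obtain ⟨a, ha, hy⟩ := hy
    have ha' : ‖a‖ < ε := mem_ball_zero_iff.mp ha
    rcases hy with ⟨z, rfl⟩ | hy
    · obtain ⟨ζ, rfl⟩ := (hkerU a ha' z ξ).mp hξ
      exact (hkerU a ha' z _).mpr ⟨(Complex.I * (show ℂ from ζ) : ℂ), (hleaf a ha').sphere.hol_u z ζ⟩
    · rw [mem_singleton_iff] at hy
      subst hy
      obtain ⟨ζ, rfl⟩ := (hkerV a ha' 0 ξ).mp hξ
      exact (hkerV a ha' 0 _).mpr ⟨(Complex.I * (show ℂ from ζ) : ℂ), (hleaf a ha').sphere.hol_v 0 ζ⟩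

end Summit.SmoothPoincare4.SmoothPoincare4.Theorems.GromovRecognitionRelEnd.CrossCapLaurent

end
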